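import Literature.Claims.NS.Permana2026
import Literature.Analysis.FluidPDE.ClassicalSobolevUniqueness
import HarnessLib

/-!
# Claim skeleton (D-0090 NS-CLAIMS, C148): Fulber, Zenodo 18411774 «Version 3.0 — Complete Proof» (2026) —
# «Global Regularity of 3D Navier-Stokes via the Alignment Gap Mechanism»

Typed skeleton of Douglas H. M. Fulber, *Global Regularity of 3D Navier-Stokes via the Alignment Gap Mechanism*,
Zenodo record 18411774 (created 2026-01-29), TEXT OF RECORD = file `navier-final.pdf` («Version 3.0 — Complete
Proof», 5 pp., PDF page = printed page, sha256[:16] `68dd52af9c58523b`; bib `Fulber2026`), lead RULINGS v1.35 (6).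
Cell `ns-claims`, typist `ns-claims-typist-3 g5`; sources `run/shared/lean/pub/ns-claims/sources/Fulber2026/`
(LOCATORS.md by `ns-claims-lit-1 g9`; the two-column Word PDF loses its displays in the text layer — every display
below was read on the 120-dpi renders `renders/p001–p004.png`); «p. N l. M» = `pages/pNNN.txt` line, «(col.)» the
render column. UNREFEREED CLAIM under adjudication — NOTHING in this file asserts a printed step: the paper's
statements are `def … : Prop`; the `theorem`s are kernel relations (composition of the paper's OWN chain, the
Clay link, the identity with the C119 `Permana2026` headline), and discharges of steps that are classical AS TYPED.
Same-record LINEAGE, not typed: `FORMAL_PROOF_LATEX.tex` (a LaTeX variant with different constants — `δ₀ =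
κ/(1+κ) ≈ 0.022`, no time average — recorded in CARD §1), `paper.pdf` / `navier.pdf` (Version 2.0).

## The claimed statement (verbatim, p. 1 box «Main Theorem (Global Regularity)»)

«For any u₀ ∈ H^s(ℝ³) with s > 5/2 and ∇·u₀ = 0, the Navier-Stokes equations admit a unique global solution:
u ∈ C([0,∞); H^s) ∩ C^∞((0,∞) × ℝ³)» for the unforced system «∂ₜu + (u·∇)u = −∇p + νΔu, ∇·u = 0» on ℝ³ (p. 1
§I); abstract: «We prove global regularity … with smooth initial data of finite energy … This resolves the Clay
Millennium Problem for Navier-Stokes.»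

RENDERING (precedent C119 `Permana2026`, C17 `Chae2007` — the «alignment-law family» vocabulary is REUSED BY
NAME): data = `Chae2007.IsDatum` (smooth, divergence free, all `L²` Sobolev norms finite = `H^∞ ⊂ H^s`; restricting
the data of a `∀`-claim WEAKENS it), solutions = the Beale–Kato–Majda class `Chae2007.IsLocalSolution ν T v₀ u p`
(classical on `ℝ³ × [0,T)`, all Sobolev norms bounded on compact sub-slabs) / `Chae2007.IsGlobalSolution`;
`ClaimedTheorem` = existence of a global class solution for every datum and every `ν > 0` — LITERALLY the C119
headline (`claimed_iff_permana`); «unique» typed separately (`ClaimedUniqueness`, classical in the class and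
DISCHARGED below from the tree's `IsClassicalNSSolutionOn.eq_of_hasBoundedSobolevNormsOn`).

## Clay delta (reference `Literature.Claims.NS.ClayVariants`, axes Δ1–Δ8)

Nearest: (A) `clayR3`. Δ1 ℝ³ =; Δ2 NS, `ν > 0` (p. 1 «νΔu»; ν's positivity implicit) =; Δ3 `f ≡ 0` =; Δ4 data
«u₀ ∈ H^s(ℝ³), s > 5/2» / abstract «smooth initial data of finite energy» — WIDER than Fefferman's class (4)
(typed over `IsDatum ⊃` Schwartz data: the claim implies the (A)-type conclusion for Clay data); Δ5/Δ6 «unique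
global solution u ∈ C([0,∞);H^s) ∩ C^∞((0,∞)×ℝ³)» — smoothness AT `t = 0`, the pressure and the energy clause (7)
are not in the sentence (classical in the BKM class: `clay_of_claimed` PROVED via the C119 door
`Permana2026.clay_of_claimed`); Δ7 all `t ≥ 0` =. No residual delta beyond the rendering.

## Vocabulary (p. 1 §II, p. 2 Thm 3.2, p. 3 §V) — eigenvector-free where the print allows

`S = ½(∇u + ∇uᵀ)`, eigenvalues `λ₁ ≥ λ₂ ≥ λ₃`, «incompressibility requires λ₁ + λ₂ + λ₃ = 0», `αᵢ = (ω̂·eᵢ)²`,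
`Σαᵢ = 1`, `σ = ω̂ᵀSω̂ = Σαᵢλᵢ` (p. 1). Rendered: `λ₁(x)` = the top of the Rayleigh quotient `⟨e, Du(x) e⟩`,
`‖e‖ = 1` (`topEig`; `⟨e, Du e⟩ = ⟨e, S e⟩`), `λ₃(x)` = its bottom (`botEig`), `λ₂ := −λ₁ − λ₃` (trace zero);
`σ|ω|² = ⟨ω, Du ω⟩`, so `∫σ|ω|² = Permana2026.stretch`; a «top eigenvector field» is any unit field attaining the
top Rayleigh value (`IsTopEigvec`), and `α₁|ω|² = ⟨ω, e₁⟩²`; enstrophy-weighted averages `⟨g⟩_Ω = ∫g|ω|²/∫|ω|²`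
(p. 3; `Ω` of the print = `½‖ω‖²₂ = enstrophy/2`, junk `0` for an irrotational slice).

## Step list (printed chain FIG. 2 p. 2 «6 steps»: Thm 3.2 → Lemma 5.1 → enstrophy control → geometric bound →
## BKM → Q.E.D.; §VII = «full proof» of Thm 3.2)

* `Step1_Thm32` — **Theorem 3.2 (Alignment Gap) p. 2 (right col. box)**, typed AS BOXED («for any smooth solution
  … on [0,T)», every `T`): time–space average of `α₁` ≤ `1 − δ₀`, `δ₀ = δ₀(ν) ∈ (0,1)` («≈ 2/3»). Typist's flag:
  SUSPICIOUS (for every `T` it contradicts data with `ω` aligned with a simple top eigenvector of its own strain;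
  §VII 7.3 p. 4 itself only reaches «≤ 1 − δ₀/2 for T sufficiently large» — `Step1w_Thm32asProved`).
* Lemma 3.1 (Pressure Dominance) p. 2 and §VII 7.1–7.3 pp. 3–4 (the «proof» of Thm 3.2: `dα₁/dt = 2α₁(1−α₁)𝒢 +
  R_vort + R_press`, `R_vort ∼ +|ω|²α₁/Δλ`, `R_press ∼ −C_H|ω|²α₁/Δλ`, «Key result |R_press| ≥ (L/a)|R_vort|»,
  Lamb–Oseen scalings, `τ_high ≤ C/(γδ₀)`) are NOT TYPED: the symbols `𝒢, R_vort, R_press, Δλ, L, a, γ, ω*` are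
  undefined in print and every relation is a «∼» (recorded in CARD §5 / LOCATORS §1 as the printed support of Step 1).
* `Step12_glue` — Step 1 → Step 2 of FIG. 2: the TIME-averaged bound of Thm 3.2 is used in Lemma 5.1 as a bound AT
  EACH TIME (`⟨α₁⟩_Ω ≤ 1 − δ₀`); typed as the implication the chain needs (unprinted; flag: unfilled gap).
* `Step2_L51` — **Lemma 5.1 p. 3 (box)** at the printed (spatially averaged) grain, non-strict (charitable);
  `Step2_L51Abs_a` / `Step2_L51Abs_b` — the two displays of its one-line proof at the real-number grain («Since
  σ = Σαᵢλᵢ and λ₁ ≥ λ₂: σ ≤ α₁λ₁ + (1−α₁)λ₂ < λ₁ whenever α₁ < 1»): (a) PROVED below; (b) the second printed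
  inequality `(1−δ₀)λ₁ + δ₀λ₂ < (1 − δ₀/2)λ₁` needs `λ₂ < λ₁/2`, which trace-freeness does not give (flag: suspicious).
* `Step3a_EnstrophyEq` — «dΩ/dt = 2Ω⟨σ⟩_Ω − ν‖∇ω‖²» p. 3 = the C119 identity (20) BY NAME (`Permana2026.Step_4`).
* `Step3b_Lambda1Estimate` — «the standard estimate ⟨λ₁⟩_Ω ≲ ‖∇ω‖^{3/2}/Ω^{1/2}» p. 3 (flag: suspicious — not
  scale-invariant: the classical bound carries `‖ω‖₂^{1/2}`, i.e. `Ω^{1/4}`, in the denominator).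
* `Step3c_Riccati` — «Optimizing over ‖∇ω‖: dΩ/dt ≤ C′(1−δ₀/2)⁴Ω²/ν³» p. 3, typed as displayed along solutions;
  `Step3c_inference` — its printed derivation «Using Lemma 5.1 and the standard estimate» (3a + 3b ⇒ 3c).
* `Step3d_BoundedFromRiccati` — «The reduced coefficient (1 − δ₀/2)⁴ < 1 slows growth, and refined analysis yields
  bounded Ω_max» p. 3: the inference from the Riccati inequality to a uniform bound, at the real-function grain
  (flag: UNFILLED GAP — no «refined analysis» is printed; the comparison ODE blows up in finite time).
* `Step3_inference` — Step 2 → Step 3 of FIG. 2 as consumed: 3b + 3d turn the per-time stretching reduction into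
  «Ω(t) ≤ Ω_max» along the solution.
* `Step4_GeometricBound` — «‖ω‖_{L∞} ≲ Ω_max^{3/2}/(E₀ν) … follows from energy and enstrophy constraints on
  concentration geometry [2,9]» p. 3 (flag: suspicious — false by spatial scaling for fields; no proof printed).
* `Step5_BKM` — «From Step 4: ‖ω‖_∞ ≤ M < ∞, so ∫₀ᵀ‖ω‖_∞ ≤ MT < ∞ for all T. No singularity can form. Q.E.D.»
  p. 3 (Beale–Kato–Majda 1984): TRUE-type in the class (tree `MajdaBertozzi2002_bkmAprioriH3_holds`).
* Composition `claim_of_steps` (with `Chae2007.Step_1`, Kato's dichotomy, kernel-true) and `clay_of_claimed` PROVED;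
  `claimedUniqueness_holds`, `step2_L51Abs_a_holds` PROVED.

WHAT THIS IS NOT: not a claim about NS regularity or blow-up; not a claim about any author beyond the typed
locator.
-/

noncomputable section

open Set Function Filter MeasureTheory
open scoped Topology ENNReal NNReal ContDiff RealInnerProductSpace

namespace Literature.Claims.NS.Fulber2026

open Literature.Analysis.FluidPDE
open Literature.Claims.NS.Chae2007 (IsDatum IsLocalSolution IsGlobalSolution BlowsUpAt l2Norm)
open Literature.Claims.NS.Permana2026 (enstrophy gradVortSq supVort stretch)

/-! ### Vocabulary (p. 1 §II; p. 3 §V) -/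

/-- `λ₁` of the strain at a point, eigenvector-free: the TOP of the Rayleigh quotient `⟨e, A e⟩` over unit vectors
(`⟨e, A e⟩ = ⟨e, S e⟩` for `S = ½(A + Aᵀ)`; p. 1 §II «eigenvalues λ₁ ≥ λ₂ ≥ λ₃»). [cite: Fulber2026, §II p.1] -/
def topEig (A : EuclideanSpace ℝ (Fin 3) →L[ℝ] EuclideanSpace ℝ (Fin 3)) : ℝ :=
  sSup ((fun e => ⟪e, A e⟫) '' Metric.sphere (0 : EuclideanSpace ℝ (Fin 3)) 1)

/-- `λ₃` of the strain at a point: the BOTTOM of the Rayleigh quotient. [cite: Fulber2026, §II p.1] -/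
def botEig (A : EuclideanSpace ℝ (Fin 3) →L[ℝ] EuclideanSpace ℝ (Fin 3)) : ℝ :=
  sInf ((fun e => ⟪e, A e⟫) '' Metric.sphere (0 : EuclideanSpace ℝ (Fin 3)) 1)

/-- `λ₂ := −λ₁ − λ₃` («Incompressibility requires λ₁ + λ₂ + λ₃ = 0», p. 1 §II; valid for trace-free strain,
i.e. along divergence-free fields). [cite: Fulber2026, §II p.1] -/
def midEig (A : EuclideanSpace ℝ (Fin 3) →L[ℝ] EuclideanSpace ℝ (Fin 3)) : ℝ :=
  -topEig A - botEig A

/-- A unit vector attaining the top Rayleigh value of `A` = a unit top eigenvector `e₁` of the symmetric part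
(p. 1 §II «eigenvectors e₁, e₂, e₃»; §VI p. 3: when `λ₁ = λ₂` any unit vector of the top eigenspace qualifies).
[cite: Fulber2026, §II p.1; §VI p.3] -/
def IsTopEigvec (A : EuclideanSpace ℝ (Fin 3) →L[ℝ] EuclideanSpace ℝ (Fin 3))
    (e : EuclideanSpace ℝ (Fin 3)) : Prop :=
  ‖e‖ = 1 ∧ ⟪e, A e⟫ = topEig A

/-- The enstrophy-weighted spatial average `⟨g⟩_Ω := ∫ g|ω|² dx / ∫ |ω|² dx` of a scalar field at time `t`
(Thm 3.2 p. 2 inner quotient; Lemma 5.1 / Step 2→3 p. 3 «⟨·⟩_Ω»); junk `0` on an irrotational slice.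
[cite: Fulber2026, Thm 3.2 p.2; §V p.3] -/
def avgW (u : ℝ → EuclideanSpace ℝ (Fin 3) → EuclideanSpace ℝ (Fin 3)) (t : ℝ)
    (g : EuclideanSpace ℝ (Fin 3) → ℝ) : ℝ :=
  (∫ x, g x * ‖curl (u t) x‖ ^ 2) / enstrophy u t

/-- `⟨λ₁⟩_Ω(t)` (p. 3). [cite: Fulber2026, Lemma 5.1 p.3] -/
def lam1Avg (u : ℝ → EuclideanSpace ℝ (Fin 3) → EuclideanSpace ℝ (Fin 3)) (t : ℝ) : ℝ :=
  avgW u t fun x => topEig (fderiv ℝ (u t) x)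

/-- `⟨λ₂⟩_Ω(t)` (p. 3). [cite: Fulber2026, Lemma 5.1 p.3] -/
def lam2Avg (u : ℝ → EuclideanSpace ℝ (Fin 3) → EuclideanSpace ℝ (Fin 3)) (t : ℝ) : ℝ :=
  avgW u t fun x => midEig (fderiv ℝ (u t) x)

/-- `⟨σ⟩_Ω(t) = ∫σ|ω|² / ∫|ω|²` with `σ|ω|² = ω̂ᵀSω̂·|ω|² = ⟨ω, ∇u ω⟩` (p. 1 «σ = ω̂ᵀSω̂»; p. 3 «dΩ/dt =
2Ω⟨σ⟩_Ω − ν‖∇ω‖²»): the C119 stretching integral over the enstrophy. [cite: Fulber2026, §II p.1; §V p.3] -/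
def sigmaAvg (u : ℝ → EuclideanSpace ℝ (Fin 3) → EuclideanSpace ℝ (Fin 3)) (t : ℝ) : ℝ :=
  stretch u t / enstrophy u t

/-- `⟨α₁⟩_Ω(t) = ∫α₁|ω|²dx / ∫|ω|²dx` for a chosen top-eigenvector field `e` (`α₁|ω|² = (ω̂·e₁)²|ω|² = ⟨ω, e₁⟩²`,
p. 1 «αᵢ = (ω̂·eᵢ)²»; Thm 3.2 p. 2). [cite: Fulber2026, §II p.1; Thm 3.2 p.2] -/
def alpha1Avg (u : ℝ → EuclideanSpace ℝ (Fin 3) → EuclideanSpace ℝ (Fin 3))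
    (e : ℝ → EuclideanSpace ℝ (Fin 3) → EuclideanSpace ℝ (Fin 3)) (t : ℝ) : ℝ :=
  avgW u t fun x => ⟪curl (u t) x, e t x⟫ ^ 2 / ‖curl (u t) x‖ ^ 2

/-- `e` is a field of unit top eigenvectors of the strain along `u` on `[0,T)` (every slice, every point).
[cite: Fulber2026, §II p.1] -/
def IsTopEigvecField (T : ℝ) (u e : ℝ → EuclideanSpace ℝ (Fin 3) → EuclideanSpace ℝ (Fin 3)) : Prop :=
  ∀ t ∈ Ico 0 T, ∀ x, IsTopEigvec (fderiv ℝ (u t) x) (e t x)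

/-- The print's `Ω(t) = ½‖ω(·,t)‖²_{L²}` (normalisation fixed by «dΩ/dt = 2Ω⟨σ⟩_Ω − ν‖∇ω‖²», p. 3).
[cite: Fulber2026, §V p.3] -/
def Ens (u : ℝ → EuclideanSpace ℝ (Fin 3) → EuclideanSpace ℝ (Fin 3)) (t : ℝ) : ℝ :=
  enstrophy u t / 2

/-- `E₀ = ½‖u₀‖²_{L²}` (the energy in «Ω_max^{3/2}/(E₀ν)», p. 3 Step 3 → 4). [cite: Fulber2026, §V p.3] -/
def E0 (v₀ : EuclideanSpace ℝ (Fin 3) → EuclideanSpace ℝ (Fin 3)) : ℝ :=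
  l2Norm v₀ ^ 2 / 2

/-! ### The claimed statement (p. 1 box) -/

/-- **HEADLINE — Main Theorem (Global Regularity), p. 1 box, existence part, AS PRINTED**: «For any u₀ ∈ H^s(ℝ³)
with s > 5/2 and ∇·u₀ = 0, the Navier-Stokes equations admit a unique global solution u ∈ C([0,∞);H^s) ∩
C^∞((0,∞)×ℝ³)» — rendered in the BKM class: every datum of `Chae2007.IsDatum` launches a global class solution,
for every `ν > 0`. [claim: Fulber2026, status: disputed] -/
def ClaimedTheorem : Prop :=
  ∀ ν : ℝ, 0 < ν → ∀ v₀ : EuclideanSpace ℝ (Fin 3) → EuclideanSpace ℝ (Fin 3), IsDatum v₀ →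
    ∃ (u : ℝ → EuclideanSpace ℝ (Fin 3) → EuclideanSpace ℝ (Fin 3)) (p : ℝ → EuclideanSpace ℝ (Fin 3) → ℝ),
      IsGlobalSolution ν v₀ u p

/-- **«unique»** (p. 1 box): two global class solutions from the same datum have the same velocity. Classical in
the class (PROVED below, `claimedUniqueness_holds`). [cite: Fulber2026, Main Theorem p.1] -/
def ClaimedUniqueness : Prop :=
  ∀ ν : ℝ, 0 < ν → ∀ v₀ : EuclideanSpace ℝ (Fin 3) → EuclideanSpace ℝ (Fin 3), IsDatum v₀ →
    ∀ (u u' : ℝ → EuclideanSpace ℝ (Fin 3) → EuclideanSpace ℝ (Fin 3)) (p p' : ℝ → EuclideanSpace ℝ (Fin 3) → ℝ),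
      IsGlobalSolution ν v₀ u p → IsGlobalSolution ν v₀ u' p' → ∀ t : ℝ, 0 ≤ t → u' t = u t

/-- The headline is LITERALLY the C119 headline (`Permana2026.ClaimedTheorem`): same class, same sentence shape.
[cite: Fulber2026, Main Theorem p.1] -/
theorem claimed_iff_permana : ClaimedTheorem ↔ Permana2026.ClaimedTheorem := Iff.rfl

/-! ### Step 1 — Theorem 3.2 (Alignment Gap), p. 2 right column (box) -/

/-- **Step 1 — Theorem 3.2 (Alignment Gap), p. 2 box, AS BOXED**: «For any smooth solution of Navier-Stokes on
[0,T): ⟨α₁⟩_{Ω,T} := (1/T)∫₀ᵀ (∫α₁|ω|²dx / ∫|ω|²dx) dt ≤ 1 − δ₀ where δ₀ ≈ 2/3 and depends only on ν and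
dimensionless ratios.» TYPED: for every `ν > 0` there is `δ₀ ∈ (0,1)` such that along every class solution on every
`[0,T)`, for EVERY choice of a unit top-eigenvector field `e` of the strain (§VI: on the degenerate set the print
uses `α_eff`; the typed «every choice» is a strengthening only there — «measure zero in spacetime», p. 3), the time
average over `[0,T]` of `⟨α₁⟩_Ω` is `≤ 1 − δ₀`. Printed support (NOT typed, see module docstring): Lemma 3.1 +
§VII («|R_press| ≫ |R_vort| ⇒ net drift of α₁ negative»), whose own last display (7.3 p. 4) gives only
`≤ 1 − δ₀/2` for `T` large (`Step1w_Thm32asProved`). Typist's flag: suspicious.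
[claim: Fulber2026, status: disputed] [cite: Fulber2026, Theorem 3.2 p.2 (box); §VII pp.3–4] -/
def Step1_Thm32 : Prop :=
  ∀ ν : ℝ, 0 < ν → ∃ δ₀ : ℝ, 0 < δ₀ ∧ δ₀ < 1 ∧
    ∀ (T : ℝ), 0 < T → ∀ (v₀ : EuclideanSpace ℝ (Fin 3) → EuclideanSpace ℝ (Fin 3))
      (u : ℝ → EuclideanSpace ℝ (Fin 3) → EuclideanSpace ℝ (Fin 3)) (p : ℝ → EuclideanSpace ℝ (Fin 3) → ℝ),
      IsLocalSolution ν T v₀ u p →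
      ∀ e : ℝ → EuclideanSpace ℝ (Fin 3) → EuclideanSpace ℝ (Fin 3), IsTopEigvecField T u e →
        (1 / T) * ∫ t in (0:ℝ)..T, alpha1Avg u e t ≤ 1 - δ₀

/-- **Step 1, the face §VII actually reaches (7.3 «Completion of Proof», p. 4 last display)**: «⟨α₁⟩_{Ω,T} ≤
1 − δ₀ + τ_high δ₀/T ≤ 1 − δ₀/2 for T sufficiently large» — an EVENTUAL bound with the halved gap (weaker than the
box; recorded as the as-proved twin, `step1w_of_step1`). [claim: Fulber2026, status: disputed]
[cite: Fulber2026, §VII 7.3 p.4] -/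
def Step1w_Thm32asProved : Prop :=
  ∀ ν : ℝ, 0 < ν → ∃ δ₀ : ℝ, 0 < δ₀ ∧ δ₀ < 1 ∧
    ∀ (T : ℝ), 0 < T → ∀ (v₀ : EuclideanSpace ℝ (Fin 3) → EuclideanSpace ℝ (Fin 3))
      (u : ℝ → EuclideanSpace ℝ (Fin 3) → EuclideanSpace ℝ (Fin 3)) (p : ℝ → EuclideanSpace ℝ (Fin 3) → ℝ),
      IsLocalSolution ν T v₀ u p →
      ∀ e : ℝ → EuclideanSpace ℝ (Fin 3) → EuclideanSpace ℝ (Fin 3), IsTopEigvecField T u e →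
        ∃ T₀ : ℝ, 0 < T₀ ∧ ∀ T' : ℝ, T₀ ≤ T' → T' ≤ T →
          (1 / T') * ∫ t in (0:ℝ)..T', alpha1Avg u e t ≤ 1 - δ₀ / 2

/-- The boxed face implies the as-proved face (with `T₀ := T`: halving the gap only weakens). Pure logic.
[cite: Fulber2026, Thm 3.2 p.2; §VII 7.3 p.4] -/
theorem step1w_of_step1 (h : Step1_Thm32) : Step1w_Thm32asProved := by
  intro ν hν
  obtain ⟨δ₀, hδ0, hδ1, hall⟩ := h ν hν
  refine ⟨δ₀, hδ0, hδ1, fun T hT v₀ u p hsol e he => ⟨T, hT, fun T' hT'T hTT' => ?_⟩⟩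
  have hTT : T' = T := le_antisymm hTT' hT'T
  subst hTT
  have := hall T' hT v₀ u p hsol e he
  linarith

/-! ### Step 1 → Step 2 (FIG. 2 p. 2): from the time average to every time -/

/-- **Glue Step 1 → Step 2** (FIG. 2 «STEP 1: Alignment Gap (… time-averaged)» → «STEP 2: Stretching Reduction»;
Lemma 5.1 p. 3 is applied with the hypothesis «⟨α₁⟩_Ω ≤ 1 − δ₀» AT EACH TIME, while Thm 3.2 bounds only the TIME
AVERAGE): typed as the implication the chain uses — along a class solution with a top-eigenvector field, the
`[0,T]`-average bound gives the bound at every `t ∈ [0,T)`. Unprinted. Typist's flag: unfilled gap.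
[claim: Fulber2026, status: disputed] [cite: Fulber2026, FIG. 2 p.2; Lemma 5.1 p.3] -/
def Step12_glue : Prop :=
  ∀ (ν δ₀ T : ℝ), 0 < ν → 0 < δ₀ → δ₀ < 1 → 0 < T →
    ∀ (v₀ : EuclideanSpace ℝ (Fin 3) → EuclideanSpace ℝ (Fin 3))
      (u : ℝ → EuclideanSpace ℝ (Fin 3) → EuclideanSpace ℝ (Fin 3)) (p : ℝ → EuclideanSpace ℝ (Fin 3) → ℝ),
      IsLocalSolution ν T v₀ u p →
      ∀ e : ℝ → EuclideanSpace ℝ (Fin 3) → EuclideanSpace ℝ (Fin 3), IsTopEigvecField T u e →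
        (1 / T) * ∫ t in (0:ℝ)..T, alpha1Avg u e t ≤ 1 - δ₀ →
          ∀ t ∈ Ico 0 T, alpha1Avg u e t ≤ 1 - δ₀

/-! ### Step 2 — Lemma 5.1, p. 3 (box) -/

/-- **Step 2 — Lemma 5.1 p. 3 (box), at the printed (spatially averaged) grain, non-strict**: «If ⟨α₁⟩_Ω ≤ 1 − δ₀,
then: ⟨σ⟩_Ω ≤ (1 − δ₀)⟨λ₁⟩_Ω + δ₀⟨λ₂⟩_Ω < (1 − δ₀/2)⟨λ₁⟩_Ω» — typed at every time of a class solution for every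
top-eigenvector field, with BOTH printed inequalities as `≤` (charitable: the strict `<` fails already for the rest
state). The second inequality needs `⟨λ₂⟩_Ω ≤ ½⟨λ₁⟩_Ω`, which «λ₁ + λ₂ + λ₃ = 0, λ₁ ≥ λ₂ ≥ λ₃» does not give
(`λ₂ = λ₁` is admissible: axisymmetric strain `(λ, λ, −2λ)`), and the first needs a correlation bound between `α₁`
and `λ₁ − λ₂` that an average of `α₁` alone does not supply. Typist's flag: suspicious.
[claim: Fulber2026, status: disputed] [cite: Fulber2026, Lemma 5.1 p.3] -/
def Step2_L51 : Prop :=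
  ∀ (ν δ₀ T : ℝ), 0 < ν → 0 < δ₀ → δ₀ < 1 → 0 < T →
    ∀ (v₀ : EuclideanSpace ℝ (Fin 3) → EuclideanSpace ℝ (Fin 3))
      (u : ℝ → EuclideanSpace ℝ (Fin 3) → EuclideanSpace ℝ (Fin 3)) (p : ℝ → EuclideanSpace ℝ (Fin 3) → ℝ),
      IsLocalSolution ν T v₀ u p →
      ∀ e : ℝ → EuclideanSpace ℝ (Fin 3) → EuclideanSpace ℝ (Fin 3), IsTopEigvecField T u e →
        ∀ t ∈ Ico 0 T, alpha1Avg u e t ≤ 1 - δ₀ →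
          sigmaAvg u t ≤ (1 - δ₀) * lam1Avg u t + δ₀ * lam2Avg u t ∧
            (1 - δ₀) * lam1Avg u t + δ₀ * lam2Avg u t ≤ (1 - δ₀ / 2) * lam1Avg u t

/-- **Lemma 5.1, first display of the PROOF at the real-number grain** («Since σ = Σᵢαᵢλᵢ and λ₁ ≥ λ₂:
σ ≤ α₁λ₁ + (1 − α₁)λ₂», p. 3), combined with the hypothesis `α₁ ≤ 1 − δ₀`: for reals `λ₁ ≥ λ₂ ≥ λ₃` and weights
`αᵢ ≥ 0`, `Σαᵢ = 1`, `α₁ ≤ 1 − δ₀` ⇒ `Σαᵢλᵢ ≤ (1 − δ₀)λ₁ + δ₀λ₂`. TRUE — PROVED below (`step2_L51Abs_a_holds`).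
[cite: Fulber2026, Lemma 5.1 proof p.3] -/
def Step2_L51Abs_a : Prop :=
  ∀ (δ₀ l₁ l₂ l₃ a₁ a₂ a₃ : ℝ), 0 < δ₀ → δ₀ < 1 → l₂ ≤ l₁ → l₃ ≤ l₂ →
    0 ≤ a₁ → 0 ≤ a₂ → 0 ≤ a₃ → a₁ + a₂ + a₃ = 1 → a₁ ≤ 1 - δ₀ →
      a₁ * l₁ + a₂ * l₂ + a₃ * l₃ ≤ (1 - δ₀) * l₁ + δ₀ * l₂

/-- **Lemma 5.1, second printed inequality at the real-number grain** («< (1 − δ₀/2)⟨λ₁⟩_Ω», box p. 3; proof: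
«< λ₁ whenever α₁ < 1»): for a trace-free ordered triple with `λ₁ > 0` (non-degenerate strain — the proviso keeps
the zero strain out, TYPING-HYGIENE) and `δ₀ ∈ (0,1)`: `(1 − δ₀)λ₁ + δ₀λ₂ < (1 − δ₀/2)λ₁`. Equivalent to
`λ₂ < λ₁/2`; the admissible triple `(1, 1, −2)` has `λ₂ = λ₁`. Typist's flag: suspicious (known-false pattern at
the algebraic grain). [claim: Fulber2026, status: disputed] [cite: Fulber2026, Lemma 5.1 p.3] -/
def Step2_L51Abs_b : Prop :=
  ∀ (δ₀ l₁ l₂ l₃ : ℝ), 0 < δ₀ → δ₀ < 1 → 0 < l₁ → l₂ ≤ l₁ → l₃ ≤ l₂ → l₁ + l₂ + l₃ = 0 →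
    (1 - δ₀) * l₁ + δ₀ * l₂ < (1 - δ₀ / 2) * l₁

/-! ### Step 3 — «Step 2 → Step 3: Enstrophy Control», p. 3 left column -/

/-- **Step 3a — «The enstrophy evolution: dΩ/dt = 2Ω⟨σ⟩_Ω − ν‖∇ω‖²_{L²}»** p. 3, `Ω = ½‖ω‖²`, `2Ω⟨σ⟩_Ω =
∫⟨ω, ∇u ω⟩`: with `E = ‖ω‖² = 2Ω` this is `dE/dt = −2ν‖∇ω‖² + 2∫(Sω·ω)`, the C119 identity (20) — REUSED BY NAME
(`Permana2026.Step_4`: continuity of `E` on `[0,T)` and the right derivative at every `t ∈ [0,T)`; classical in the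
class). [cite: Fulber2026, §V Step 2→3 p.3] -/
def Step3a_EnstrophyEq : Prop :=
  Permana2026.Step_4

/-- **Step 3b — «the standard estimate ⟨λ₁⟩_Ω ≲ ‖∇ω‖^{3/2}/Ω^{1/2}»** p. 3, typed along class solutions with one
constant per viscosity (`≲`): `⟨λ₁⟩_Ω(t) ≤ C ‖∇ω(t)‖₂^{3/2} / Ω(t)^{1/2}` (`‖∇ω‖₂^{3/2} = gradVortSq^{3/4}`).
Typist's flag: suspicious — under the Navier–Stokes scaling `u_λ(t,x) = λu(λ²t,λx)` the left side scales like
`λ²` and the right like `λ^{7/4}` (the classical estimate `∫λ₁|ω|² ≤ C‖ω‖₂^{3/2}‖∇ω‖₂^{3/2}` has `Ω^{1/4}`, not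
`Ω^{1/2}`, downstairs). [claim: Fulber2026, status: disputed] [cite: Fulber2026, §V Step 2→3 p.3] -/
def Step3b_Lambda1Estimate : Prop :=
  ∀ ν : ℝ, 0 < ν → ∃ C : ℝ, 0 ≤ C ∧ ∀ (T : ℝ), 0 < T →
    ∀ (v₀ : EuclideanSpace ℝ (Fin 3) → EuclideanSpace ℝ (Fin 3))
      (u : ℝ → EuclideanSpace ℝ (Fin 3) → EuclideanSpace ℝ (Fin 3)) (p : ℝ → EuclideanSpace ℝ (Fin 3) → ℝ),
      IsLocalSolution ν T v₀ u p → ∀ t ∈ Ico 0 T,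
        lam1Avg u t ≤ C * gradVortSq u t ^ ((3:ℝ) / 4) / Ens u t ^ ((1:ℝ) / 2)

/-- **Step 3c — «Optimizing over ‖∇ω‖: dΩ/dt ≤ C′(1 − δ₀/2)⁴Ω²/ν³»** p. 3 (from «dΩ/dt ≤ C(1−δ₀/2)Ω^{1/2}‖∇ω‖^{3/2}
− ν‖∇ω‖²» by Young), typed as displayed: for `ν > 0`, `δ₀ ∈ (0,1)` there is `C′ ≥ 0` such that along every class
solution whose stretching is reduced as in Lemma 5.1's conclusion at every time, the right derivative of `Ω` within
`[t, ∞)` is `≤ C′(1 − δ₀/2)⁴Ω(t)²/ν³` at every `t ∈ [0,T)`. (Its printed derivation uses 3a + 3b; typed as the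
display it is.) [claim: Fulber2026, status: disputed] [cite: Fulber2026, §V Step 2→3 p.3] -/
def Step3c_Riccati : Prop :=
  ∀ (ν δ₀ : ℝ), 0 < ν → 0 < δ₀ → δ₀ < 1 → ∃ C' : ℝ, 0 ≤ C' ∧ ∀ (T : ℝ), 0 < T →
    ∀ (v₀ : EuclideanSpace ℝ (Fin 3) → EuclideanSpace ℝ (Fin 3))
      (u : ℝ → EuclideanSpace ℝ (Fin 3) → EuclideanSpace ℝ (Fin 3)) (p : ℝ → EuclideanSpace ℝ (Fin 3) → ℝ),
      IsLocalSolution ν T v₀ u p →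
      (∀ t ∈ Ico 0 T, sigmaAvg u t ≤ (1 - δ₀ / 2) * lam1Avg u t) →
        ∀ t ∈ Ico 0 T, ∃ D : ℝ, HasDerivWithinAt (Ens u) D (Ici t) t ∧
          D ≤ C' * (1 - δ₀ / 2) ^ 4 * Ens u t ^ 2 / ν ^ 3

/-- **Step 3c as DERIVED in print** («Using Lemma 5.1 and the standard estimate ⟨λ₁⟩_Ω ≲ ‖∇ω‖^{3/2}/Ω^{1/2}:
dΩ/dt ≤ C(1 − δ₀/2)Ω^{1/2}‖∇ω‖^{3/2} − ν‖∇ω‖². Optimizing over ‖∇ω‖: …», p. 3): the enstrophy identity (3a) and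
the «standard estimate» (3b) give the Riccati display (3c) (algebra + Young's inequality; TRUE-type as an
implication, typed so that 3a and 3b sit on the composition path). [claim: Fulber2026, status: disputed]
[cite: Fulber2026, §V Step 2→3 p.3] -/
def Step3c_inference : Prop :=
  Step3a_EnstrophyEq → Step3b_Lambda1Estimate → Step3c_Riccati

/-- **Step 3d — «The reduced coefficient (1 − δ₀/2)⁴ < 1 slows growth, and refined analysis yields bounded Ω_max»**
p. 3, typed at the real-function grain as the inference the sentence asserts: for `k > 0` and `Ω₀ ≥ 0` there is
`Ω_max` such that EVERY nonnegative function on EVERY `[0,T)` starting at `Ω₀` whose right derivative obeys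
`Ω' ≤ kΩ²` stays `≤ Ω_max`. No «refined analysis» is printed; the comparison equation `y' = ky²` leaves every bound
in finite time. Typist's flag: UNFILLED GAP (known-false pattern at the ODE grain).
[claim: Fulber2026, status: disputed] [cite: Fulber2026, §V Step 2→3 p.3 (last two sentences)] -/
def Step3d_BoundedFromRiccati : Prop :=
  ∀ (k Ω₀ : ℝ), 0 < k → 0 ≤ Ω₀ → ∃ Ωmax : ℝ, ∀ (T : ℝ), 0 < T → ∀ (y D : ℝ → ℝ), y 0 = Ω₀ →
    (∀ t ∈ Ico 0 T, 0 ≤ y t) → (∀ t ∈ Ico 0 T, HasDerivWithinAt y (D t) (Ici t) t ∧ D t ≤ k * y t ^ 2) →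
      ∀ t ∈ Ico 0 T, y t ≤ Ωmax

/-- «Ω(t) ≤ Ω_max on [0,T)» for a solution (FIG. 2 «STEP 3: Enstrophy Control», FIG. 3 «saturates at Ω_max»).
[cite: Fulber2026, FIG. 2 p.2; §V p.3] -/
def EnstrophyBounded (T : ℝ) (u : ℝ → EuclideanSpace ℝ (Fin 3) → EuclideanSpace ℝ (Fin 3)) : Prop :=
  ∃ Ωmax : ℝ, ∀ t ∈ Ico 0 T, Ens u t ≤ Ωmax

/-- **Step 2 → Step 3 as consumed by the chain** (FIG. 2; p. 3 «Using Lemma 5.1 and the standard estimate …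
Optimizing … refined analysis yields bounded Ω_max»): GIVEN the Riccati display (3c) and the boundedness inference
(3d), a class solution with reduced stretching at every time has bounded `Ω` on `[0,T)`. Typed as the implication;
its kernel proof would be bookkeeping (3c ⇒ hypotheses of 3d with `k = C′(1−δ₀/2)⁴/ν³`), left as a step because
3d's nonnegativity/derivative side conditions are part of what the print leaves implicit.
[claim: Fulber2026, status: disputed] [cite: Fulber2026, §V Step 2→3 p.3] -/
def Step3_inference : Prop :=
  Step3c_Riccati → Step3d_BoundedFromRiccati →
    ∀ (ν δ₀ T : ℝ), 0 < ν → 0 < δ₀ → δ₀ < 1 → 0 < T →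
      ∀ (v₀ : EuclideanSpace ℝ (Fin 3) → EuclideanSpace ℝ (Fin 3))
        (u : ℝ → EuclideanSpace ℝ (Fin 3) → EuclideanSpace ℝ (Fin 3)) (p : ℝ → EuclideanSpace ℝ (Fin 3) → ℝ),
        IsLocalSolution ν T v₀ u p →
        (∀ t ∈ Ico 0 T, sigmaAvg u t ≤ (1 - δ₀ / 2) * lam1Avg u t) → EnstrophyBounded T u

/-! ### Step 4 — «Step 3 → Step 4: Geometric Bounds», p. 3 -/

/-- **Step 4 — «‖ω‖_{L∞} ≲ Ω_max^{3/2}/(E₀ν). This follows from energy and enstrophy constraints on concentration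
geometry [2,9]»** p. 3, typed along class solutions with one constant (`≲`): `‖ω(t)‖_∞ ≤ C Ω(t)^{3/2}/(E₀ν)`,
`E₀ = ½‖u₀‖²`. No proof printed. Typist's flag: suspicious — sup norms are not controlled by energy and enstrophy
(spatial concentration at fixed `‖ω‖₂`), and the display is not scale-invariant.
[claim: Fulber2026, status: disputed] [cite: Fulber2026, §V Step 3→4 p.3] -/
def Step4_GeometricBound : Prop :=
  ∀ ν : ℝ, 0 < ν → ∃ C : ℝ, 0 ≤ C ∧ ∀ (T : ℝ), 0 < T →
    ∀ (v₀ : EuclideanSpace ℝ (Fin 3) → EuclideanSpace ℝ (Fin 3))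
      (u : ℝ → EuclideanSpace ℝ (Fin 3) → EuclideanSpace ℝ (Fin 3)) (p : ℝ → EuclideanSpace ℝ (Fin 3) → ℝ),
      IsLocalSolution ν T v₀ u p → ∀ t ∈ Ico 0 T,
        supVort u t ≤ C * Ens u t ^ ((3:ℝ) / 2) / (E0 v₀ * ν)

/-! ### Step 5 — «Step 4 → Step 5 → Step 6: BKM Criterion», p. 3 right column -/

/-- **Step 5 — BKM as used** («Theorem (Beale-Kato-Majda, 1984): If ∫₀^{T*}‖ω‖_{L∞}dt < ∞, then the solution
remains smooth on [0,T*]. From Step 4: ‖ω‖_{L∞} ≤ M < ∞, so ∫₀ᵀ‖ω‖_{L∞}dt ≤ MT < ∞ for all T. No singularity can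
form. Q.E.D.», p. 3): a class solution on `[0,T)` with `sup_x|ω|` bounded on `[0,T)` does not blow up at `T`.
TRUE-type (Majda–Bertozzi Thm 3.6; tree `MajdaBertozzi2002_bkmAprioriH3_holds` + the bookkeeping of C119
`Permana2026.Step_9`). [cite: Fulber2026, §V Step 4→6 p.3; BealeKatoMajda1984] -/
def Step5_BKM : Prop :=
  ∀ (ν T : ℝ), 0 < ν → 0 < T →
    ∀ (v₀ : EuclideanSpace ℝ (Fin 3) → EuclideanSpace ℝ (Fin 3))
      (u : ℝ → EuclideanSpace ℝ (Fin 3) → EuclideanSpace ℝ (Fin 3)) (p : ℝ → EuclideanSpace ℝ (Fin 3) → ℝ),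
      IsLocalSolution ν T v₀ u p → (∃ M : ℝ, ∀ t ∈ Ico 0 T, supVort u t ≤ M) → ¬ BlowsUpAt T u

/-! ### Kernel relations: composition of the printed chain, Clay link, discharged steps -/

/-- **COMPOSITION — FIG. 2 «6 steps to global regularity» in the printed order, closed by Kato's dichotomy
(`Chae2007.Step_1`, kernel-true).** Fix `ν > 0`, a datum `v₀`; if no global class solution exists, take the
maximal class solution on `[0,T)` blowing up at `T` (`Chae2007.Step_1`). Step 1 gives `δ₀` and the time-averaged
gap for any top-eigenvector field (one exists pointwise: the unit sphere is compact — chosen by `Classical.choice`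
below from `exists_isTopEigvec`); the glue gives the per-time gap; Step 2 the per-time stretching reduction; Step 3
(3a + 3b ⇒ 3c by `Step3c_inference`, then 3c + 3d by `Step3_inference`) bounded `Ω`; Step 4 bounded `‖ω‖_∞`; Step 5 no blow-up — contradiction. Pure logic otherwise;
nothing is asserted. [claim: Fulber2026, status: disputed] -/
theorem claim_of_steps (h0 : Chae2007.Step_1) (h1 : Step1_Thm32) (h12 : Step12_glue) (h2 : Step2_L51)
    (h3a : Step3a_EnstrophyEq) (h3b : Step3b_Lambda1Estimate) (h3ci : Step3c_inference)
    (h3d : Step3d_BoundedFromRiccati) (h3 : Step3_inference) (h4 : Step4_GeometricBound) (h5 : Step5_BKM)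
    (hev : ∀ A : EuclideanSpace ℝ (Fin 3) →L[ℝ] EuclideanSpace ℝ (Fin 3), ∃ e, IsTopEigvec A e) :
    ClaimedTheorem := by
  have h3c : Step3c_Riccati := h3ci h3a h3b
  intro ν hν v₀ hv₀
  rcases h0 ν hν.le v₀ hv₀ with hglob | ⟨T, hT, u, p, hsol, hblow⟩
  · exact hglob
  · exfalso
    -- a top-eigenvector field
    classical
    let e : ℝ → EuclideanSpace ℝ (Fin 3) → EuclideanSpace ℝ (Fin 3) :=
      fun t x => Classical.choose (hev (fderiv ℝ (u t) x))
    have he : IsTopEigvecField T u e := fun t _ x => Classical.choose_spec (hev (fderiv ℝ (u t) x))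
    obtain ⟨δ₀, hδ0, hδ1, hgap⟩ := h1 ν hν
    have havg := hgap T hT v₀ u p hsol e he
    have hpt : ∀ t ∈ Ico 0 T, alpha1Avg u e t ≤ 1 - δ₀ :=
      h12 ν δ₀ T hν hδ0 hδ1 hT v₀ u p hsol e he havg
    have hσ : ∀ t ∈ Ico 0 T, sigmaAvg u t ≤ (1 - δ₀ / 2) * lam1Avg u t := by
      intro t ht
      obtain ⟨ha, hb⟩ := h2 ν δ₀ T hν hδ0 hδ1 hT v₀ u p hsol e he t ht (hpt t ht)
      exact ha.trans hb
    obtain ⟨Ωmax, hΩ⟩ := h3 h3c h3d ν δ₀ T hν hδ0 hδ1 hT v₀ u p hsol hσ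
    obtain ⟨C, hC0, hC⟩ := h4 ν hν
    have hM : ∃ M : ℝ, ∀ t ∈ Ico 0 T, supVort u t ≤ M := by
      refine ⟨max (C * (max Ωmax 0) ^ ((3:ℝ) / 2) / (E0 v₀ * ν)) 0, fun t ht => ?_⟩
      have h1t := hC T hT v₀ u p hsol t ht
      have hEns0 : 0 ≤ Ens u t := by
        unfold Ens Permana2026.enstrophy
        exact div_nonneg ENNReal.toReal_nonneg (by norm_num)
      have hEle : Ens u t ≤ max Ωmax 0 := (hΩ t ht).trans (le_max_left _ _)
      have hpow : Ens u t ^ ((3:ℝ) / 2) ≤ (max Ωmax 0) ^ ((3:ℝ) / 2) :=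
        Real.rpow_le_rpow hEns0 hEle (by norm_num)
      have hE0 : 0 ≤ E0 v₀ * ν := by
        refine mul_nonneg ?_ hν.le
        unfold E0
        exact div_nonneg (sq_nonneg _) (by norm_num)
      rcases hE0.lt_or_eq with hE | hE
      · calc supVort u t ≤ C * Ens u t ^ ((3:ℝ) / 2) / (E0 v₀ * ν) := h1t
          _ ≤ C * (max Ωmax 0) ^ ((3:ℝ) / 2) / (E0 v₀ * ν) := by gcongr
          _ ≤ _ := le_max_left _ _
      · have : supVort u t ≤ 0 := by simpa [← hE] using h1t
        exact this.trans (le_max_right _ _)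
    exact h5 ν T hν hT v₀ u p hsol hM hblow

/-- Unit top eigenvectors exist (the unit sphere of `ℝ³` is compact and nonempty and the Rayleigh quotient is
continuous; p. 1 §II «eigenvectors e₁, e₂, e₃») — the side input `hev` of `claim_of_steps`, PROVED.
[cite: Fulber2026, §II p.1] -/
theorem exists_isTopEigvec (A : EuclideanSpace ℝ (Fin 3) →L[ℝ] EuclideanSpace ℝ (Fin 3)) :
    ∃ e, IsTopEigvec A e := by
  have hK : IsCompact (Metric.sphere (0 : EuclideanSpace ℝ (Fin 3)) 1) := isCompact_sphere _ _
  have hne : (Metric.sphere (0 : EuclideanSpace ℝ (Fin 3)) 1).Nonempty := by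
    refine ⟨EuclideanSpace.single 0 1, ?_⟩
    simp
  have hcont : ContinuousOn (fun e : EuclideanSpace ℝ (Fin 3) => ⟪e, A e⟫) (Metric.sphere 0 1) :=
    (continuous_id.inner A.continuous).continuousOn
  obtain ⟨e, he, hmax⟩ := hK.exists_isMaxOn hne hcont
  refine ⟨e, by simpa using he, ?_⟩
  unfold topEig
  refine le_antisymm ?_ ?_
  · exact le_csSup ((hK.image_of_continuousOn hcont).isBounded.bddAbove) (mem_image_of_mem _ he)
  · exact csSup_le (hne.image _) (by rintro _ ⟨e', he', rfl⟩; exact hmax he')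

/-- **The composition with the side input discharged.** [claim: Fulber2026, status: disputed] -/
theorem claim_of_steps' (h0 : Chae2007.Step_1) (h1 : Step1_Thm32) (h12 : Step12_glue) (h2 : Step2_L51)
    (h3a : Step3a_EnstrophyEq) (h3b : Step3b_Lambda1Estimate) (h3ci : Step3c_inference)
    (h3d : Step3d_BoundedFromRiccati) (h3 : Step3_inference) (h4 : Step4_GeometricBound) (h5 : Step5_BKM) :
    ClaimedTheorem :=
  claim_of_steps h0 h1 h12 h2 h3a h3b h3ci h3d h3 h4 h5 exists_isTopEigvec

/-- **`ClaimedTheorem` implies Clay (A)** — through the C119 door (`Permana2026.clay_of_claimed`: Clay data are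
class data, the class solution is smooth on `ℝ³ × [0,∞)` with bounded energy). [cite: FeffermanClay2006, statement (A), CMI offprint p. 2] -/
theorem clay_of_claimed (h : ClaimedTheorem) : ClayVariants.clayR3.Regularity :=
  Permana2026.clay_of_claimed (claimed_iff_permana.1 h)

/-- **«unique» holds in the class** (Main Theorem p. 1): two global class solutions from the same datum agree at
every `t ≥ 0`, by the tree's uniqueness of classical solutions with bounded Sobolev norms
(`IsClassicalNSSolutionOn.eq_of_hasBoundedSobolevNormsOn`, Majda–Bertozzi Cor. 3.1) on `[0, t+1]`.
[cite: Fulber2026, Main Theorem p.1] [cite: MajdaBertozziCUP2002, Cor. 3.1] -/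
theorem claimedUniqueness_holds : ClaimedUniqueness := by
  intro ν hν v₀ _ u u' p p' hu hu' t ht
  have hT : (0:ℝ) < t + 1 := by linarith
  have hcu : IsClassicalNSSolutionOn (Icc 0 (t + 1)) ν 0 u p :=
    hu.isClassical.mono Icc_subset_Ici_self (uniqueDiffOn_Icc hT)
  have hcu' : IsClassicalNSSolutionOn (Icc 0 (t + 1)) ν 0 u' p' :=
    hu'.isClassical.mono Icc_subset_Ici_self (uniqueDiffOn_Icc hT)
  have h0 : u' 0 = u 0 := by rw [hu'.initial, hu.initial]
  exact hcu'.eq_of_hasBoundedSobolevNormsOn hcu hν.le hT (hu'.sobolev (t + 1)) (hu.sobolev (t + 1)) h0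
    ⟨ht, by linarith⟩

/-- **Lemma 5.1's first proof display holds** (real-number grain): `Σαᵢλᵢ ≤ α₁λ₁ + (1 − α₁)λ₂ ≤ (1 − δ₀)λ₁ + δ₀λ₂`
(the second step uses `λ₂ ≤ λ₁` and `α₁ ≤ 1 − δ₀`). [cite: Fulber2026, Lemma 5.1 proof p.3] -/
theorem step2_L51Abs_a_holds : Step2_L51Abs_a := by
  intro δ₀ l₁ l₂ l₃ a₁ a₂ a₃ _ _ h12 h23 _ ha2 ha3 hsum ha1
  have h3 : a₃ = 1 - a₁ - a₂ := by linarith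
  subst h3
  nlinarith [mul_nonneg ha2 (sub_nonneg.2 h12), mul_nonneg ha3 (sub_nonneg.2 (h23.trans h12)),
    mul_nonneg ha3 (sub_nonneg.2 h23), mul_nonneg (sub_nonneg.2 ha1) (sub_nonneg.2 h12),
    sub_nonneg.2 h12]

/-! ### Rev 2 (typist-3 g5, after REF FORMAL-PREP (A) and the TYPED record): a non-vacuous §VII 7.3 twin, and
### Step 5 discharged in the class -/

/-- **§VII 7.3 twin, re-typed with the threshold INSIDE the interval** (REF FORMAL-PREP ref-4 g5 (A): the first
typing `Step1w_Thm32asProved` lets `T₀ > T` empty the range and is vacuous — it stays as the recorded twin; this is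
the non-vacuous reading): «⟨α₁⟩_{Ω,T} ≤ 1 − δ₀ + τ_high δ₀/T ≤ 1 − δ₀/2 for T sufficiently large» (p. 4), with
`T₀ ≤ T` so that at least `T' = T` is constrained. Off the composition path (the chain composes with the box,
`Step1_Thm32`). [claim: Fulber2026, status: disputed] [cite: Fulber2026, §VII 7.3 p.4] -/
def Step1w'_Thm32asProvedBound : Prop :=
  ∀ ν : ℝ, 0 < ν → ∃ δ₀ : ℝ, 0 < δ₀ ∧ δ₀ < 1 ∧
    ∀ (T : ℝ), 0 < T → ∀ (v₀ : EuclideanSpace ℝ (Fin 3) → EuclideanSpace ℝ (Fin 3))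
      (u : ℝ → EuclideanSpace ℝ (Fin 3) → EuclideanSpace ℝ (Fin 3)) (p : ℝ → EuclideanSpace ℝ (Fin 3) → ℝ),
      IsLocalSolution ν T v₀ u p →
      ∀ e : ℝ → EuclideanSpace ℝ (Fin 3) → EuclideanSpace ℝ (Fin 3), IsTopEigvecField T u e →
        ∃ T₀ : ℝ, 0 < T₀ ∧ T₀ ≤ T ∧ ∀ T' : ℝ, T₀ ≤ T' → T' ≤ T →
          (1 / T') * ∫ t in (0:ℝ)..T', alpha1Avg u e t ≤ 1 - δ₀ / 2

/-- The boxed face implies the bound-threshold twin as well (`T₀ := T`). Pure logic.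
[cite: Fulber2026, Thm 3.2 p.2; §VII 7.3 p.4] -/
theorem step1w'_of_step1 (h : Step1_Thm32) : Step1w'_Thm32asProvedBound := by
  intro ν hν
  obtain ⟨δ₀, hδ0, hδ1, hall⟩ := h ν hν
  refine ⟨δ₀, hδ0, hδ1, fun T hT v₀ u p hsol e he => ⟨T, hT, le_rfl, fun T' hT'T hTT' => ?_⟩⟩
  have hTT : T' = T := le_antisymm hTT' hT'T
  subst hTT
  have := hall T' hT v₀ u p hsol e he
  linarith

/-- The bound-threshold twin implies the recorded (vacuous-able) one. Pure logic.
[cite: Fulber2026, §VII 7.3 p.4] -/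
theorem step1w_of_step1w' (h : Step1w'_Thm32asProvedBound) : Step1w_Thm32asProved := by
  intro ν hν
  obtain ⟨δ₀, hδ0, hδ1, hall⟩ := h ν hν
  refine ⟨δ₀, hδ0, hδ1, fun T hT v₀ u p hsol e he => ?_⟩
  obtain ⟨T₀, hT₀, -, hb⟩ := hall T hT v₀ u p hsol e he
  exact ⟨T₀, hT₀, hb⟩

/-- In the class, `sup_x ‖ω(t,x)‖ₑ` is finite at every `t ∈ [0,T)` (Sobolev imbedding `W^{2,2} ⊂ C_B` on the
compact sub-slab `[0, (t+T)/2]`, tree `exists_enorm_curl_le_of_hasBoundedSobolevNormsOn`).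
[cite: MajdaBertozziCUP2002, §3.2 (BKM class)] -/
theorem iSup_enorm_curl_lt_top {ν T : ℝ} {v₀ : EuclideanSpace ℝ (Fin 3) → EuclideanSpace ℝ (Fin 3)}
    {u : ℝ → EuclideanSpace ℝ (Fin 3) → EuclideanSpace ℝ (Fin 3)} {p : ℝ → EuclideanSpace ℝ (Fin 3) → ℝ}
    (hsol : IsLocalSolution ν T v₀ u p) {t : ℝ} (ht : t ∈ Ico 0 T) :
    (⨆ x, ‖curl (u t) x‖ₑ) < ⊤ := by
  have hT'' : (t + T) / 2 < T := by linarith [ht.2]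
  have htI : t ∈ Icc 0 ((t + T) / 2) := ⟨ht.1, by linarith [ht.2]⟩
  obtain ⟨R, hRtop, hR⟩ := exists_enorm_curl_le_of_hasBoundedSobolevNormsOn
    (fun s hs => hsol.isClassical.contDiff_velocity ⟨hs.1, hs.2.trans_lt hT''⟩) (hsol.sobolev _ hT'')
  exact (iSup_le fun x => hR t htI x).trans_lt hRtop

/-- **Step 5 (BKM as used, p. 3) HOLDS in the class**: a uniform bound `sup_x|ω| ≤ M` over `[0,T)` makes the
BKM integral `∫₀ᵀ sup_x‖ω‖ₑ ≤ M·T` finite, so the Majda–Bertozzi a priori `H³` bound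
(`MajdaBertozzi2002_bkmAprioriH3_holds`) excludes blow-up at `T` — exactly the print's «∫₀ᵀ‖ω‖_{L∞}dt ≤ MT < ∞
… No singularity can form». [cite: Fulber2026, §V Step 4→6 p.3] [cite: BealeKatoMajda1984, Thm 1] -/
theorem step5_BKM_holds : Step5_BKM := by
  intro ν T hν hT v₀ u p hsol hM hblow
  obtain ⟨M, hM⟩ := hM
  have hpt : ∀ t ∈ Ioo 0 T, ∀ y, ‖curl (u t) y‖ ≤ max M 0 := by
    intro t ht y
    have htI : t ∈ Ico 0 T := ⟨ht.1.le, ht.2⟩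
    have hfin := iSup_enorm_curl_lt_top hsol htI
    have hle : ‖curl (u t) y‖ₑ ≤ ⨆ x, ‖curl (u t) x‖ₑ := le_iSup (fun x => ‖curl (u t) x‖ₑ) y
    have h1 : ‖curl (u t) y‖ ≤ supVort u t := by
      have := ENNReal.toReal_mono hfin.ne hle
      rwa [← ofReal_norm, ENNReal.toReal_ofReal (norm_nonneg _)] at this
    exact h1.trans ((hM t htI).trans (le_max_left _ _))
  have hBKM : (∫⁻ t in Ioo 0 T, ⨆ y, ‖curl (u t) y‖ₑ) < ⊤ := by
    have hle : (∫⁻ t in Ioo 0 T, ⨆ y, ‖curl (u t) y‖ₑ) ≤ ∫⁻ _ in Ioo 0 T, ENNReal.ofReal (max M 0) := by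
      refine setLIntegral_mono' measurableSet_Ioo fun t ht => iSup_le fun y => ?_
      rw [← ofReal_norm]
      exact ENNReal.ofReal_le_ofReal (hpt t ht y)
    refine hle.trans_lt ?_
    rw [setLIntegral_const, Real.volume_Ioo]
    exact ENNReal.mul_lt_top ENNReal.ofReal_lt_top ENNReal.ofReal_lt_top
  obtain ⟨A, hA⟩ := MajdaBertozzi2002_bkmAprioriH3_holds hν.le hT hsol.isClassical hsol.sobolev hBKM
  exact hblow ⟨A, hA⟩

end Literature.Claims.NS.Fulber2026

end

-- WHAT THIS IS NOT: not a claim about NS regularity or blow-up; not a claim about any author beyond the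
-- typed locator.
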